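import Summits.BirchSwinnertonDyer.BirchSwinnertonDyer.Theorems.ClassRecordThreeCartanOnePlaceDegreeLawAtThreeSheetUnfolding
import Literature.NumberTheory.Automorphic.ShimuraCurveDataExistence
import Literature.NumberTheory.EllipticCurves.ModularDegreeFormulaProofs
import HarnessLib

/-!
# Crux NUM `CartanOnePlaceDegreeLawAtThree` (item 24801) — first inputs of (GRAM)

Seat `bsd-stepL-tam3-p1` g30 (LEAD of 24801; `--supports` 24801). Two of the inputs of the last open
content stub `(GRAM)` `PeterssonGram` of the `petarea` cut of (PET) (`Cruxes/…/Lines/petarea.lean`):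

* `exists_isHypFundamentalDomain_principalLevel` — `Γ̄(q)` HAS a measurable exact fundamental domain
  (the `∃ Fq` of (GRAM)); `isDiscreteSubgroup_coverUnits ∕ _principalLevel ∕ _levelOf` (subgroups of the
  discrete `ι(O₀'¹)`; cf. the tree's `IsDiscreteSubgroup.mono`);
* `setLIntegral_pet_pos` — **PETERSSON POSITIVITY on an arbitrary countable `Γ ≤ SL₂(ℝ)`-image, NO `−1 ∈ Γ`
  needed**: for a fundamental domain `F` of `Γ` and a cusp form `f ∈ S₂(Γ)` that is not identically zero,
  `0 < ∫⁻_F ‖f‖² y² dμ` (the definiteness of the Gram matrix of (GRAM)). Proof: if the integral vanishes,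
  `Φ = ‖f‖² y²` vanishes a.e. on `F`; unfolding over `Γ{±1}` (`tsum_setLIntegral_smul_eq`, `F` is also a
  `Γ{±1}`-domain and `Φ` is `Γ{±1}`-invariant because `−1` acts trivially) gives `∫⁻_ℍ Φ = 0`, so `Φ = 0`
  a.e.; but `{f = 0}` is countable (`countable_setOf_cuspForm_eq_zero`), hence null, so `ℍ` would be null,
  contradicting `vol(𝒟) = π/3`.

Nothing about NUM or any curve; BSD is proved for no curve. [cite: Iwaniec2002, §2.2–2.3] [cite: ShimuraIATAF1971, §2.1]
-/

set_option linter.dupNamespace false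
set_option autoImplicit false

noncomputable section

open scoped Classical Pointwise MatrixGroups ModularForm ENNReal UpperHalfPlane
open MeasureTheory ConjAct Matrix

namespace Summit.BirchSwinnertonDyer.BirchSwinnertonDyer.Theorems.CartanCover

open Literature.NumberTheory.Automorphic Literature.NumberTheory.EllipticCurves.ModularForms

/-! ## Petersson positivity on an arbitrary `Γ` -/

/-- `-1` lies in the image of `SL₂(ℝ)`. -/
theorem neg_one_mem_range_toGL :
    (-1 : GL (Fin 2) ℝ) ∈ (Matrix.SpecialLinearGroup.toGL : SL(2, ℝ) →* GL (Fin 2) ℝ).range :=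
  modular_le_range_toGL neg_one_mem_modular

/-- `Γ{±1}` lies in the image of `SL₂(ℝ)` when `Γ` does. -/
theorem adjoinNegOne_le_range_toGL {Γ : Subgroup (GL (Fin 2) ℝ)}
    (hΓ : Γ ≤ (Matrix.SpecialLinearGroup.toGL : SL(2, ℝ) →* GL (Fin 2) ℝ).range) :
    Γ.adjoinNegOne ≤ (Matrix.SpecialLinearGroup.toGL : SL(2, ℝ) →* GL (Fin 2) ℝ).range := by
  intro g hg
  rcases Subgroup.mem_adjoinNegOne_iff.mp hg with h | h
  · exact hΓ h
  · have h1 := Subgroup.mul_mem _ neg_one_mem_range_toGL (hΓ h)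
    simpa using h1

/-- `Γ{±1}` is countable when `Γ` is. -/
theorem countable_adjoinNegOne {Γ : Subgroup (GL (Fin 2) ℝ)} (hc : (Γ : Set (GL (Fin 2) ℝ)).Countable) :
    ((Γ.adjoinNegOne : Subgroup (GL (Fin 2) ℝ)) : Set (GL (Fin 2) ℝ)).Countable := by
  have hsub : ((Γ.adjoinNegOne : Subgroup (GL (Fin 2) ℝ)) : Set (GL (Fin 2) ℝ)) ⊆
      (Γ : Set (GL (Fin 2) ℝ)) ∪ (fun g => -g) '' (Γ : Set (GL (Fin 2) ℝ)) := by
    intro g hg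
    rcases Subgroup.mem_adjoinNegOne_iff.mp hg with h | h
    · exact Or.inl h
    · exact Or.inr ⟨-g, h, neg_neg g⟩
  exact (hc.union (hc.image _)).mono hsub

/-- **Petersson positivity.** For a countable `Γ ≤ GL₂(ℝ)` inside the image of `SL₂(ℝ)` (no `−1 ∈ Γ` needed),
a fundamental domain `F` of `Γ` and `f ∈ S₂(Γ)` not identically zero: `0 < ∫⁻_F ‖f τ‖² (Im τ)² dμ`.
[cite: Iwaniec2002, §2.2–2.3] -/
theorem setLIntegral_pet_pos {Γ : Subgroup (GL (Fin 2) ℝ)}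
    (hΓ : Γ ≤ (Matrix.SpecialLinearGroup.toGL : SL(2, ℝ) →* GL (Fin 2) ℝ).range)
    (hc : (Γ : Set (GL (Fin 2) ℝ)).Countable) {F : Set ℍ} (hF : IsHypFundamentalDomain Γ F)
    (f : CuspForm Γ 2) (hf : (⇑f : ℍ → ℂ) ≠ 0) :
    0 < ∫⁻ τ in F, ENNReal.ofReal (‖f τ‖ ^ 2 * τ.im ^ 2) := by
  haveI : Γ.HasDetOne := ⟨fun {g} hg => (hΓ hg).elim fun s hs => by rw [← hs]; simp⟩
  rw [pos_iff_ne_zero]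
  intro h0
  set Φ : ℍ → ℝ≥0∞ := fun τ => ENNReal.ofReal (‖f τ‖ ^ 2 * τ.im ^ 2) with hΦ
  have hΦm : Measurable Φ := measurable_pet f.holo'.continuous
  -- `Φ` is `Γ{±1}`-invariant
  have hinv : ∀ γ ∈ Γ.adjoinNegOne, ∀ w : ℍ, Φ (γ • w) = Φ w := by
    intro γ hγ w
    rcases Subgroup.mem_adjoinNegOne_iff.mp hγ with h | h
    · exact pet_smul_of_mem f h w
    · rw [← neg_neg γ, UpperHalfPlane.neg_smul]
      exact pet_smul_of_mem f h w
  -- unfolding over `Γ{±1}`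
  have hunf := tsum_setLIntegral_smul_eq (adjoinNegOne_le_range_toGL hΓ) (Subgroup.negOne_mem_adjoinNegOne Γ)
    (countable_adjoinNegOne hc) hF.adjoinNegOne hΦm.aemeasurable
  have hterm : ∀ γ : Γ.adjoinNegOne, ∫⁻ w in F, Φ ((γ : GL (Fin 2) ℝ) • w) = 0 := by
    intro γ
    simp_rw [hinv γ γ.2]
    exact h0
  simp_rw [hterm, tsum_zero] at hunf
  have hall : ∫⁻ w, Φ w = 0 := by
    have h2 : (2 : ℝ≥0∞) ≠ 0 := two_ne_zero
    rcases mul_eq_zero.mp hunf.symm with h | h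
    · exact absurd h h2
    · exact h
  -- so `Φ = 0` a.e., i.e. `{Φ ≠ 0}` is null
  have hae : volume {τ : ℍ | Φ τ ≠ 0} = 0 := by
    have h := (lintegral_eq_zero_iff hΦm).mp hall
    rw [Filter.EventuallyEq, ae_iff] at h
    simpa using h
  -- `{f = 0}` is countable, hence null
  have hZ : volume {τ : ℍ | f τ = 0} = 0 := by
    apply volume_eq_zero_of_image_coe
    exact ((countable_setOf_cuspForm_eq_zero f hf).image _).measure_zero _
  -- hence `ℍ` is null — absurd
  have huniv : volume (Set.univ : Set ℍ) = 0 := by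
    refine measure_mono_null (fun τ _ => ?_) (measure_union_null hae hZ)
    by_cases hτ : f τ = 0
    · exact Or.inr hτ
    · refine Or.inl ?_
      show Φ τ ≠ 0
      have hpos : 0 < ‖f τ‖ ^ 2 * τ.im ^ 2 := by
        have h1 : 0 < ‖f τ‖ := norm_pos_iff.mpr hτ
        have h2 : 0 < τ.im := τ.im_pos
        positivity
      intro hzero
      rw [ENNReal.ofReal_eq_zero] at hzero
      exact absurd hzero (not_le.mpr hpos)
  have hfd : volume ModularGroup.fd = 0 := measure_mono_null (Set.subset_univ _) huniv
  rw [volume_modular_fd, ENNReal.ofReal_eq_zero] at hfd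
  exact absurd hfd (not_le.mpr (by positivity))

variable {D M : ℕ} {C : Finset ℕ} {X : CartanLevelCurveData D M C} {q : ℕ}

/-! ## Discreteness and fundamental domains of the level groups -/

/-- `ι(O₀'¹)` is discrete. -/
theorem isDiscreteSubgroup_coverUnits (X : CartanLevelCurveData D M C) (q : ℕ) : IsDiscreteSubgroup (coverUnits X q) :=
  CartanTransport.Hull.isDiscreteSubgroup_normOneUnits X.ι (isOrder_coverOrder X q)

/-- `Γ̄(q)` is discrete. -/
theorem isDiscreteSubgroup_principalLevel (X : CartanLevelCurveData D M C) (q : ℕ) :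
    IsDiscreteSubgroup (principalLevel X q) :=
  fun r =>
  (isDiscreteSubgroup_coverUnits X q r).subset fun _ hγ => ⟨principalLevel_le_coverUnits X q hγ.1, hγ.2⟩

/-- **`Γ̄(q)` has a measurable exact fundamental domain** (the `∃ Fq` of (GRAM)). -/
theorem exists_isHypFundamentalDomain_principalLevel (X : CartanLevelCurveData D M C) (q : ℕ) :
    ∃ F : Set ℍ, IsHypFundamentalDomain (principalLevel X q) F :=
  exists_isHypFundamentalDomain_of_isDiscreteSubgroup
    ((principalLevel_le_coverUnits X q).trans (coverUnits_le_range_toGL X q)) (isDiscreteSubgroup_principalLevel X q)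

namespace CoverReduction

variable [Fact q.Prime] (R : CoverReduction X q)

/-- `Γ_T` is discrete. -/
theorem isDiscreteSubgroup_levelOf (T : Subgroup (GL (Fin 2) (ZMod q))) : IsDiscreteSubgroup (R.levelOf T) :=
  fun r =>
  (isDiscreteSubgroup_coverUnits X q r).subset fun _ hγ => ⟨R.levelOf_le T hγ.1, hγ.2⟩

/-- `Γ_T` has a measurable exact fundamental domain. -/
theorem exists_isHypFundamentalDomain_levelOf (T : Subgroup (GL (Fin 2) (ZMod q))) :
    ∃ F : Set ℍ, IsHypFundamentalDomain (R.levelOf T) F :=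
  exists_isHypFundamentalDomain_of_isDiscreteSubgroup (R.levelOf_le_range_toGL T) (R.isDiscreteSubgroup_levelOf T)

/-- **Positivity of the Petersson norm of a non-zero component of an induced vector** over any `Γ̄(q)`-domain. -/
theorem setLIntegral_pet_pos_of_ne_zero {Fq : Set ℍ} (hFq : IsHypFundamentalDomain (principalLevel X q) Fq)
    (v : R.IndCuspForm) (g : GL (Fin 2) (ZMod q)) (hv : (⇑(v.1 g) : ℍ → ℂ) ≠ 0) :
    0 < ∫⁻ τ in Fq, ENNReal.ofReal (‖(v.1 g) τ‖ ^ 2 * τ.im ^ 2) :=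
  setLIntegral_pet_pos ((principalLevel_le_coverUnits X q).trans (coverUnits_le_range_toGL X q))
    (countable_principalLevel X q) hFq (v.1 g) hv

end CoverReduction

end Summit.BirchSwinnertonDyer.BirchSwinnertonDyer.Theorems.CartanCover

end
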